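import Mathlib
import Summits.ValiantsHypothesis.ValiantsHypothesis.Theses.LacunarySymmetroid

/-!
# Route LacunarySymmetroid — `OneTermSector` (item stmt-ValiantsHypothesis-18053)

The one-term format `K = 1` of the matrix Descartes rule: for a real `m × m` matrix `S` and an
exponent `e`, the determinant of the one-term lacunary pencil `X ^ e • S` is
`(X ^ e) ^ m * C (det S)`, whose only possible real zero is `0`.  Hence the set of distinct real
zeros has at most one element.

No literature is needed: this is `Matrix.det_smul` plus the fact that a nonzero multiple of a
power of `X` vanishes only at `0`.
-/

-- `Summit.ValiantsHypothesis.ValiantsHypothesis.…` is the tree's mandated single-conjunct layout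
-- (Sub = Summit), so the duplicated namespace component is intended.
set_option linter.dupNamespace false

namespace Summit.ValiantsHypothesis.ValiantsHypothesis.Theorems.LacunarySymmetroid

open Polynomial

/-- The determinant of the one-term pencil `X ^ e • S` (entries of `S` embedded as constants) is
`(X ^ e) ^ m * C (det S)`. -/
theorem det_X_pow_smul_map_C (m e : ℕ) (S : Matrix (Fin m) (Fin m) ℝ) :
    Matrix.det (((X : ℝ[X]) ^ e) • S.map C) = ((X : ℝ[X]) ^ e) ^ m * C (Matrix.det S) := by
  rw [Matrix.det_smul, Fintype.card_fin]
  congr 1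
  have h := (RingHom.map_det (Polynomial.C : ℝ →+* ℝ[X]) S)
  rw [RingHom.mapMatrix_apply] at h
  exact h.symm

/-- Every real root of `det (X ^ e • S)` is `0`: the finset of distinct roots is contained in
`{0}`. -/
theorem roots_toFinset_det_X_pow_smul_subset (m e : ℕ) (S : Matrix (Fin m) (Fin m) ℝ) :
    (Matrix.det (((X : ℝ[X]) ^ e) • S.map C)).roots.toFinset ⊆ {0} := by
  intro x hx
  rw [Multiset.mem_toFinset, mem_roots', det_X_pow_smul_map_C] at hx
  obtain ⟨hne, hroot⟩ := hx
  rw [Finset.mem_singleton]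
  have hdet : Matrix.det S ≠ 0 := by
    intro h0
    apply hne
    rw [h0, map_zero, mul_zero]
  have heval : (x ^ e) ^ m * Matrix.det S = 0 := by
    have := hroot
    rw [IsRoot.def, eval_mul, eval_pow, eval_pow, eval_X, eval_C] at this
    exact this
  have hpow : (x ^ e) ^ m = 0 := by
    rcases mul_eq_zero.mp heval with h | h
    · exact h
    · exact absurd h hdet
  exact eq_zero_of_pow_eq_zero (eq_zero_of_pow_eq_zero hpow)

/-- **OneTermSector** (route LacunarySymmetroid, item stmt-ValiantsHypothesis-18053): the one-term
lacunary pencil `X ^ e • S` has at most one distinct real zero of its determinant (namely `0`,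
and only when `det S ≠ 0` and `e * m ≠ 0`). -/
theorem oneTermSector_proof :
    Summit.ValiantsHypothesis.ValiantsHypothesis.Theses.LacunarySymmetroid.OneTermSector := by
  unfold Summit.ValiantsHypothesis.ValiantsHypothesis.Theses.LacunarySymmetroid.OneTermSector
  intro m e S
  calc (Matrix.det (((X : ℝ[X]) ^ e) • S.map C)).roots.toFinset.card
      ≤ ({0} : Finset ℝ).card := Finset.card_le_card (roots_toFinset_det_X_pow_smul_subset m e S)
    _ = 1 := Finset.card_singleton 0

end Summit.ValiantsHypothesis.ValiantsHypothesis.Theorems.LacunarySymmetroid
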